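import Mathlib
import Summits.Ventures.PercRepro2.LeafHalfCross

/-!
# Theorem (B) of row (LEAF-½) for general cluster events in the `o`- and `b`-slots
(blind cell PercRepro2, p5 g28; `proofs/P5-OEDGE.md` §37)

`LeafHalfCross.crossB_nonneg` is theorem (B): under `Q = {a₁ ↮ a₂}`,
`N(H_v H_o) ≤ N(H_o) + ⟨H_o⟩·N(H_v)` with `N(Y) = −Cov_Q(L_b, Y)`. Its proof uses the three marks
only through the shape of their events: `v ∈ C₂` enters through the PAIR AVOIDANCE `a₂ ↮ {a₁, v}`
(BHK06 Thm 1.4 under avoidance), while `o ∈ C₂` and `b ∈ C₁` enter only as an increasing event of the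
cluster `C₂` resp. `C₁`. So the theorem holds verbatim for an ARBITRARY up-set `𝓗` of `C₂` in the
`o`-slot and an arbitrary up-set `𝓛` of `C₁` in the `b`-slot (hitting events `{T ∩ C₂ ≠ ∅}`,
`{B ∩ C₁ ≠ ∅}`, containment events `{T ⊆ C₂}`, …), the `v`-slot staying a single vertex:

  `crossBGen_nonneg : 0 ≤ crossBGen p ends a₁ a₂ (connEvent ends a₂ v) (clusterInEvent ends a₂ 𝓗) (clusterInEvent ends a₁ 𝓛)`.

`crossBGen` is the cleared `(B)`-form for three events (`crossB_eq_crossBGen`: `crossB` is the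
instance `𝓗 = {o ∈ ·}`, `𝓛 = {b ∈ ·}`). The three BHK inputs are stated for the general events
(`cross_pair_avoid_gen`, `anticov_nonneg_gen`, `same_cluster_gen`); the certificate identity
`[Q − P(Q, vH)]·crossBGen = Q²·s₁ + s₂·s₃` is the one of `crossB_nonneg`.

Why this generality and not more: the census of p5 g28 (kit j320222, `mining/p5/g28/`) finds the
full «G2» grouping `groupL ≥ 0` (the candidate of record for the row) true with hitting SETS in the
`o`- and `b`-slots but FALSE for a hitting set `{v, w}` in the `v`-slot (exact witness at `n = 6`);
this file records the half of that picture that is a theorem.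
-/

namespace Summit.Ventures.PercRepro2

open UnionCluster CovForm PendantRoot LeafStep LeafHalfCross

namespace CrossBGen

variable {V : Type*} {E : Type*} [Fintype E] [DecidableEq E] [Fintype V] [DecidableEq V]
  {R : Type*} [Field R] [LinearOrder R] [IsStrictOrderedRing R]

variable (p : E → R) (ends : E → Sym2 V)

/-- **The cleared `(B)`-form for three events** — `X` in the `v`-slot, `H` in the `o`-slot, `L` in
the `b`-slot: `Q·anticov(H, L) + P(Q, H)·anticov(X, L) − [Q·P(Q, L)·P(Q, X, H) − Q²·P(Q, X, H, L)]`
(`= Q³·[Cov_Q(1_L, 1_X 1_H) − ⟨1_H⟩ Cov_Q(1_L, 1_X) − Cov_Q(1_L, 1_H)]`). -/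
noncomputable def crossBGen (a₁ a₂ : V) (X H L : Set (Config E)) : R :=
  prob p (avoidAll ends a₂ {a₁}) * anticov p ends a₁ a₂ H L +
    prob p (avoidAll ends a₂ {a₁} ∩ H) * anticov p ends a₁ a₂ X L -
    (prob p (avoidAll ends a₂ {a₁}) * prob p (avoidAll ends a₂ {a₁} ∩ L) *
        prob p (avoidAll ends a₂ {a₁} ∩ (X ∩ H)) -
      prob p (avoidAll ends a₂ {a₁}) ^ 2 *
        prob p (avoidAll ends a₂ {a₁} ∩ (X ∩ (H ∩ L))))

omit [Fintype V] [DecidableEq V] [LinearOrder R] [IsStrictOrderedRing R] in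
/-- `crossB` is the instance `X = {v ∈ C₂}`, `H = {o ∈ C₂}`, `L = {b ∈ C₁}`. -/
lemma crossB_eq_crossBGen (o a₁ a₂ v b : V) :
    crossB p ends o a₁ a₂ v b =
      crossBGen p ends a₁ a₂ (connEvent ends a₂ v) (connEvent ends a₂ o) (connEvent ends a₁ b) :=
  rfl

/-! ## The three BHK inputs for general events -/

section Inputs

variable {𝓗 𝓛 : Set (Set V)}

/-- **BHK06 Thm 1.4 under the pair avoidance `{a₂ ↮ a₁, a₂ ↮ v}`** for an up-set `𝓗` of `C₂` and an
up-set `𝓛` of `C₁`, in `Q`-masses. -/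
theorem cross_pair_avoid_gen (hp : IsProbVec p) (a₁ a₂ v : V) (h𝓗 : IsUpperSet 𝓗)
    (h𝓛 : IsUpperSet 𝓛) :
    (prob p (avoidAll ends a₂ {a₁} ∩ (clusterInEvent ends a₂ 𝓗 ∩ clusterInEvent ends a₁ 𝓛)) -
        prob p (avoidAll ends a₂ {a₁} ∩
          (connEvent ends a₂ v ∩ (clusterInEvent ends a₂ 𝓗 ∩ clusterInEvent ends a₁ 𝓛)))) *
      (prob p (avoidAll ends a₂ {a₁}) - prob p (avoidAll ends a₂ {a₁} ∩ connEvent ends a₂ v)) ≤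
    (prob p (avoidAll ends a₂ {a₁} ∩ clusterInEvent ends a₂ 𝓗) -
        prob p (avoidAll ends a₂ {a₁} ∩ (connEvent ends a₂ v ∩ clusterInEvent ends a₂ 𝓗))) *
      (prob p (avoidAll ends a₂ {a₁} ∩ clusterInEvent ends a₁ 𝓛) -
        prob p (avoidAll ends a₂ {a₁} ∩ (connEvent ends a₂ v ∩ clusterInEvent ends a₁ 𝓛))) := by
  have h := bhk_cross_cluster_avoid p hp ends a₂ a₁ (X := {a₁, v}) (Finset.mem_insert_self a₁ {v})
    h𝓗 h𝓛
  rw [prob_inter_avoidAll_pair, prob_inter_avoidAll_pair, prob_inter_avoidAll_pair,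
    prob_avoidAll_pair] at h
  exact h

/-- **BHK06 Thm 1.4 under `Q`, cleared**, for `v ∈ C₂` against an up-set `𝓛` of `C₁`:
`0 ≤ anticov(vH, 𝓛)`. -/
theorem anticov_nonneg_gen (hp : IsProbVec p) (a₁ a₂ v : V) (h𝓛 : IsUpperSet 𝓛) :
    0 ≤ anticov p ends a₁ a₂ (connEvent ends a₂ v) (clusterInEvent ends a₁ 𝓛) := by
  have h := bhk_cross_cluster p hp ends a₁ a₂ h𝓛 (isUpperSet_mem_setOf v)
  rw [← connEvent_eq_clusterInEvent ends a₂ v, ← avoidAll_eq_compl] at h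
  have e1 : clusterInEvent ends a₁ 𝓛 ∩ avoidAll ends a₂ {a₁} =
      avoidAll ends a₂ {a₁} ∩ clusterInEvent ends a₁ 𝓛 := Set.inter_comm _ _
  have e2 : connEvent ends a₂ v ∩ avoidAll ends a₂ {a₁} =
      avoidAll ends a₂ {a₁} ∩ connEvent ends a₂ v := Set.inter_comm _ _
  have e3 : clusterInEvent ends a₁ 𝓛 ∩ connEvent ends a₂ v ∩ avoidAll ends a₂ {a₁} =
      avoidAll ends a₂ {a₁} ∩ (connEvent ends a₂ v ∩ clusterInEvent ends a₁ 𝓛) := by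
    rw [Set.inter_comm, Set.inter_comm (clusterInEvent ends a₁ 𝓛)]
  rw [e1, e2, e3] at h
  unfold anticov
  linarith

/-- **BHK06 Thm 1.1 under `Q`** for `v ∈ C₂` and an up-set `𝓗` of `C₂`, in `Q`-masses:
`P(Q, vH)·P(Q, 𝓗) ≤ P(Q, vH, 𝓗)·P(Q)`. -/
theorem same_cluster_gen (hp : IsProbVec p) (a₁ a₂ v : V) (h𝓗 : IsUpperSet 𝓗) :
    prob p (avoidAll ends a₂ {a₁} ∩ connEvent ends a₂ v) *
        prob p (avoidAll ends a₂ {a₁} ∩ clusterInEvent ends a₂ 𝓗) ≤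
      prob p (avoidAll ends a₂ {a₁} ∩ (connEvent ends a₂ v ∩ clusterInEvent ends a₂ 𝓗)) *
        prob p (avoidAll ends a₂ {a₁}) := by
  have h := bhk_same_cluster_events p hp ends a₂ a₁ (isUpperSet_mem_setOf v) h𝓗
  rw [← connEvent_eq_clusterInEvent ends a₂ v, ← Q_eq_compl_conn] at h
  have e1 : connEvent ends a₂ v ∩ avoidAll ends a₂ {a₁} =
      avoidAll ends a₂ {a₁} ∩ connEvent ends a₂ v := Set.inter_comm _ _
  have e2 : clusterInEvent ends a₂ 𝓗 ∩ avoidAll ends a₂ {a₁} =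
      avoidAll ends a₂ {a₁} ∩ clusterInEvent ends a₂ 𝓗 := Set.inter_comm _ _
  have e3 : connEvent ends a₂ v ∩ clusterInEvent ends a₂ 𝓗 ∩ avoidAll ends a₂ {a₁} =
      avoidAll ends a₂ {a₁} ∩ (connEvent ends a₂ v ∩ clusterInEvent ends a₂ 𝓗) :=
    Set.inter_comm _ _
  rw [e1, e2, e3] at h
  exact h

end Inputs

/-! ## The theorem -/

/-- **THEOREM (B) for general events**: `0 ≤ crossBGen(vH, 𝓗, 𝓛)` for every up-set `𝓗` of `C₂`
(the `o`-slot) and every up-set `𝓛` of `C₁` (the `b`-slot) — under `Q`,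
`N(H_v 1_𝓗) ≤ N(1_𝓗) + ⟨1_𝓗⟩·N(H_v)` with `N(Y) = −Cov_Q(1_𝓛, Y)`. The proof is that of
`LeafHalfCross.crossB_nonneg`: the identity `[Q − P(Q,vH)]·crossBGen = Q²·s₁ + s₂·s₃` with the
three slacks `s₁` (`cross_pair_avoid_gen`), `s₂` (`anticov_nonneg_gen`), `s₃` (`same_cluster_gen`). -/
theorem crossBGen_nonneg (hp : IsProbVec p) (a₁ a₂ v : V) {𝓗 𝓛 : Set (Set V)}
    (h𝓗 : IsUpperSet 𝓗) (h𝓛 : IsUpperSet 𝓛) :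
    0 ≤ crossBGen p ends a₁ a₂ (connEvent ends a₂ v) (clusterInEvent ends a₂ 𝓗)
      (clusterInEvent ends a₁ 𝓛) := by
  have hF1 := cross_pair_avoid_gen p ends hp a₁ a₂ v h𝓗 h𝓛
  have hF2 := anticov_nonneg_gen p ends hp a₁ a₂ v h𝓛
  have hF3 := same_cluster_gen p ends hp a₁ a₂ v h𝓗
  unfold crossBGen
  unfold anticov at hF2 ⊢
  set Q := prob p (avoidAll ends a₂ {a₁}) with hQ
  set B := prob p (avoidAll ends a₂ {a₁} ∩ clusterInEvent ends a₁ 𝓛) with hB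
  set O := prob p (avoidAll ends a₂ {a₁} ∩ clusterInEvent ends a₂ 𝓗) with hO
  set Vm := prob p (avoidAll ends a₂ {a₁} ∩ connEvent ends a₂ v) with hV
  set BO := prob p (avoidAll ends a₂ {a₁} ∩
    (clusterInEvent ends a₂ 𝓗 ∩ clusterInEvent ends a₁ 𝓛)) with hBO
  set BV := prob p (avoidAll ends a₂ {a₁} ∩
    (connEvent ends a₂ v ∩ clusterInEvent ends a₁ 𝓛)) with hBV
  set VO := prob p (avoidAll ends a₂ {a₁} ∩
    (connEvent ends a₂ v ∩ clusterInEvent ends a₂ 𝓗)) with hVO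
  set BVO := prob p (avoidAll ends a₂ {a₁} ∩
    (connEvent ends a₂ v ∩ (clusterInEvent ends a₂ 𝓗 ∩ clusterInEvent ends a₁ 𝓛))) with hBVO
  -- the three nonnegative slacks
  have hs1 : 0 ≤ (O - VO) * (B - BV) - (BO - BVO) * (Q - Vm) := by linarith
  have hs2 : 0 ≤ Vm * B - Q * BV := hF2
  have hs3 : 0 ≤ Q * VO - O * Vm := by linarith
  -- the bounds that settle the degenerate case `P(Q, v ∉ C₂) = 0`
  have hW : 0 ≤ Q - Vm := by
    rw [← prob_avoidAll_pair]; exact prob_nonneg hp _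
  have hBp : B - BV ≤ Q - Vm := by
    rw [← prob_avoidAll_pair, ← prob_inter_avoidAll_pair]
    exact prob_mono hp Set.inter_subset_right
  have hOp : O - VO ≤ Q - Vm := by
    rw [← prob_avoidAll_pair, ← prob_inter_avoidAll_pair]
    exact prob_mono hp Set.inter_subset_right
  have hBOp : BO - BVO ≤ Q - Vm := by
    rw [← prob_avoidAll_pair, ← prob_inter_avoidAll_pair]
    exact prob_mono hp Set.inter_subset_right
  -- the certificate identity
  have key : (Q - Vm) * (Q * (O * B - Q * BO) + O * (Vm * B - Q * BV) -
      (Q * B * VO - Q ^ 2 * BVO)) =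
      Q ^ 2 * ((O - VO) * (B - BV) - (BO - BVO) * (Q - Vm)) +
        (Vm * B - Q * BV) * (Q * VO - O * Vm) := by
    ring
  rcases lt_or_eq_of_le hW with hWpos | hWzero
  · by_contra hneg
    have hneg' := lt_of_not_ge hneg
    have : (Q - Vm) * (Q * (O * B - Q * BO) + O * (Vm * B - Q * BV) -
        (Q * B * VO - Q ^ 2 * BVO)) < 0 := mul_neg_of_pos_of_neg hWpos hneg'
    nlinarith [mul_nonneg (sq_nonneg Q) hs1, mul_nonneg hs2 hs3]
  · -- `P(Q, v ∉ C₂) = 0`: every `¬v`-mass vanishes and the form is `0`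
    have hBp0 : 0 ≤ B - BV := by
      rw [← prob_inter_avoidAll_pair]; exact prob_nonneg hp _
    have hOp0 : 0 ≤ O - VO := by
      rw [← prob_inter_avoidAll_pair]; exact prob_nonneg hp _
    have hBOp0 : 0 ≤ BO - BVO := by
      rw [← prob_inter_avoidAll_pair]; exact prob_nonneg hp _
    have e1 : B = BV := by linarith
    have e2 : O = VO := by linarith
    have e3 : BO = BVO := by linarith
    have e4 : Vm = Q := by linarith
    rw [e1, e2, e3, e4]
    ring_nf
    exact le_refl _

/-- **Theorem (B) for hitting sets**: `o` replaced by a vertex set `T` (the event `T ∩ C₂ ≠ ∅`),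
`b` by a vertex set `B` (the event `B ∩ C₁ ≠ ∅`). -/
theorem crossBGen_nonneg_hitting (hp : IsProbVec p) (a₁ a₂ v : V) (T B : Set V) :
    0 ≤ crossBGen p ends a₁ a₂ (connEvent ends a₂ v)
      (clusterInEvent ends a₂ {W | (T ∩ W).Nonempty})
      (clusterInEvent ends a₁ {W | (B ∩ W).Nonempty}) :=
  crossBGen_nonneg p ends hp a₁ a₂ v
    (fun _ _ h hW => hW.mono (Set.inter_subset_inter_right _ h))
    (fun _ _ h hW => hW.mono (Set.inter_subset_inter_right _ h))

/-- `crossB_nonneg` recovered from the general theorem. -/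
theorem crossB_nonneg' (hp : IsProbVec p) (o a₁ a₂ v b : V) : 0 ≤ crossB p ends o a₁ a₂ v b := by
  rw [crossB_eq_crossBGen, connEvent_eq_clusterInEvent ends a₂ o,
    connEvent_eq_clusterInEvent ends a₁ b]
  exact crossBGen_nonneg p ends hp a₁ a₂ v (isUpperSet_mem_setOf o) (isUpperSet_mem_setOf b)

end CrossBGen

end Summit.Ventures.PercRepro2
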